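import Mathlib
import HarnessLib
import Literature.AlgebraicGeometry.Resolution.CobordantBlowupFiltration

/-!
# S1a — (G1a) Veronese normalisation, part 1: kernel atoms of an exponent monoid and the Veronese lemma for ideal filtrations

[OURS · L1 W4.5c · lead-1 g6] — NOT a statement of the manuscript; counted 0; AI-level work, weaker than expert
review. Crux stmt-ResolutionOfSingularities-17941 (`WildQuotients.CyclicQuotientFourfolds`), line `s1a-logminvertex`,
stub `stub_localGame`, producer residue **(G1a) `CoarseChart.VeroneseNormalisation`** (H4a `…S1aCoarseChart`, plan-1
LEAD1-GEN6-BRIEF A5a). This file holds the two generic ingredients of its proof; part 2 (`…S1aVeroneseNormalisation`)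
applies them to the degree-`0` trace of a weighted filtration. Proof-only file: no definitions, the two predicates
"kernel vector" (`∑ j, v j • δ j = 0`) and "atom" are spelled out.

* §1 **Kernel atoms (Dickson).** For a finite index type `M`, degrees `δ : M → ι` in an additive commutative group and
  exponent vectors `v : M → ℕ` with total degree `∑ j, v j • δ j`, the kernel vectors (total degree `0`) form a
  saturated submonoid of `ℕ^M`; its ATOMS (non-zero kernel vectors `v` such that every kernel vector `u ≤ v` is `0`
  or `v`) form an antichain, hence a FINITE set by Dickson's lemma (Mathlib `Pi.wellQuasiOrderedLE`), and every kernel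
  vector is an `ℕ`-combination of atoms (`exists_atom_decomposition`, well-founded induction). Consequence used
  downstream, for the additive `ℕ`-weight `∑ j, v j * wt j`: **`exists_peel`** — there are `d > 0` and `N` such that
  every kernel vector of weight `≥ N` splits as a sum of two kernel vectors the first of which has weight EXACTLY `d`
  (pigeonhole on the atom multiplicities, `d = ∏ weight (atom)` over the atoms of positive weight,
  `N = #{such atoms} · d + 1`).
* §2 **Veronese lemma for ideal filtrations** (the ideal-theoretic form of Bourbaki, Alg. Comm. III §1 no. 3 Prop. 3 /
  EGA II (2.1.6)): if an ideal filtration `F` (Literature `IdealFiltration`, [cite: Wlodarczyk2022, §2.2]) satisfies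
  `F_n ≤ F_d · F_{n-d}` for all `n ≥ N` with `d > 0`, then `e := d (N + 1)` is a Veronese degree:
  `F_{e l} = F_e ^ l` for every `l` (`idealFiltration_exists_veronese_of_peel`).
-/

set_option linter.dupNamespace false

noncomputable section

open Literature.AlgebraicGeometry.Resolution

namespace Summit.ResolutionOfSingularities.ResolutionOfSingularities.Theorems.WildQuotientResolution.S1.Veronese

/-! ## §1 Kernel atoms of an exponent monoid -/

section Atoms

variable {M : Type*} [Fintype M] {ι : Type*} [AddCommGroup ι] (δ : M → ι)

/-- The total degree `∑ⱼ vⱼ • δⱼ` is additive in the exponent vector. [OURS · L1 W4.5c] -/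
theorem deg_add (u v : M → ℕ) : ∑ j, (u + v) j • δ j = ∑ j, u j • δ j + ∑ j, v j • δ j := by
  simp only [Pi.add_apply, add_smul, Finset.sum_add_distrib]

/-- Total degree of an `ℕ`-multiple. [OURS · L1 W4.5c] -/
theorem deg_nsmul (n : ℕ) (v : M → ℕ) : ∑ j, (n • v) j • δ j = n • ∑ j, v j • δ j := by
  simp only [Pi.smul_apply, smul_eq_mul, Finset.smul_sum, mul_smul]

/-- Total degree of a truncated difference `v - u` with `u ≤ v`. [OURS · L1 W4.5c] -/
theorem deg_tsub {u v : M → ℕ} (h : u ≤ v) : ∑ j, (v - u) j • δ j = ∑ j, v j • δ j - ∑ j, u j • δ j := by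
  rw [eq_sub_iff_add_eq, ← deg_add, tsub_add_cancel_of_le h]

variable {δ} in
/-- Kernel vectors (total degree `0`) are closed under addition. [OURS · L1 W4.5c] -/
theorem ker_add {u v : M → ℕ} (hu : ∑ j, u j • δ j = 0) (hv : ∑ j, v j • δ j = 0) :
    ∑ j, (u + v) j • δ j = 0 := by
  rw [deg_add, hu, hv, add_zero]

variable {δ} in
/-- Kernel vectors are closed under `ℕ`-multiples. [OURS · L1 W4.5c] -/
theorem ker_nsmul {v : M → ℕ} (hv : ∑ j, v j • δ j = 0) (n : ℕ) : ∑ j, (n • v) j • δ j = 0 := by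
  rw [deg_nsmul, hv, smul_zero]

variable {δ} in
/-- The kernel is SATURATED: a truncated difference of comparable kernel vectors is a kernel vector.
[OURS · L1 W4.5c] -/
theorem ker_tsub {u v : M → ℕ} (hu : ∑ j, u j • δ j = 0) (hv : ∑ j, v j • δ j = 0) (h : u ≤ v) :
    ∑ j, (v - u) j • δ j = 0 := by
  rw [deg_tsub δ h, hu, hv, sub_zero]

/-- ATOMS of the kernel — non-zero kernel vectors with no kernel vector strictly between `0` and them — form an
antichain for the product order. [OURS · L1 W4.5c] -/
theorem isAntichain_atoms : IsAntichain (· ≤ ·) {v : M → ℕ | ∑ j, v j • δ j = 0 ∧ v ≠ 0 ∧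
      ∀ u : M → ℕ, ∑ j, u j • δ j = 0 → u ≤ v → u = 0 ∨ u = v} := by
  intro a ha b hb hne hle
  rcases hb.2.2 a ha.1 hle with h | h
  · exact ha.2.1 h
  · exact hne h

/-- **Dickson**: the set of atoms is finite. [OURS · L1 W4.5c] -/
theorem atoms_finite : {v : M → ℕ | ∑ j, v j • δ j = 0 ∧ v ≠ 0 ∧
      ∀ u : M → ℕ, ∑ j, u j • δ j = 0 → u ≤ v → u = 0 ∨ u = v}.Finite :=
  (isAntichain_atoms δ).finite_of_partiallyWellOrderedOn (Set.isPWO_of_wellQuasiOrderedLE _)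

/-- Every kernel vector is an `ℕ`-combination of atoms. [OURS · L1 W4.5c] -/
theorem exists_atom_decomposition {v : M → ℕ} (hv : ∑ j, v j • δ j = 0) :
    ∃ Λ : (M → ℕ) →₀ ℕ, (∀ a ∈ Λ.support, ∑ j, a j • δ j = 0 ∧ a ≠ 0 ∧
      ∀ u : M → ℕ, ∑ j, u j • δ j = 0 → u ≤ a → u = 0 ∨ u = a) ∧ v = Λ.sum (fun a n => n • a) := by
  induction v using WellFoundedLT.induction with
  | ind v ih =>
    by_cases h0 : v = 0
    · exact ⟨0, by simp, by simp [h0]⟩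
    by_cases hat : ∀ u : M → ℕ, ∑ j, u j • δ j = 0 → u ≤ v → u = 0 ∨ u = v
    · refine ⟨Finsupp.single v 1, ?_, by simp⟩
      intro a ha
      obtain ⟨rfl, -⟩ := Finsupp.mem_support_single _ _ _ |>.mp ha
      exact ⟨hv, h0, hat⟩
    -- not an atom: some kernel vector `u` lies strictly between `0` and `v`
    push Not at hat
    obtain ⟨u, hu, hle, hu0, huv⟩ := hat
    have hlt₁ : u < v := lt_of_le_of_ne hle huv
    have hlt₂ : v - u < v := by
      -- `u ≠ 0` has a positive coordinate, along which `v - u < v`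
      obtain ⟨j, hj⟩ := Function.ne_iff.mp hu0
      refine lt_of_le_not_ge tsub_le_self fun h => ?_
      have h1 : v j ≤ v j - u j := h j
      have h2 : u j ≤ v j := hle j
      have h3 : u j ≠ 0 := hj
      omega
    obtain ⟨Λ₁, hΛ₁, hv₁⟩ := ih u hlt₁ hu
    obtain ⟨Λ₂, hΛ₂, hv₂⟩ := ih (v - u) hlt₂ (ker_tsub hu hv hle)
    refine ⟨Λ₁ + Λ₂, fun a ha => ?_, ?_⟩
    · rcases Finset.mem_union.mp (Finsupp.support_add ha) with h | h
      · exact hΛ₁ a h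
      · exact hΛ₂ a h
    · rw [Finsupp.sum_add_index' (h := fun a n => n • a) (fun a => zero_smul ℕ a)
        (fun a b₁ b₂ => add_smul b₁ b₂ a), ← hv₁, ← hv₂, add_tsub_cancel_of_le hle]

/-! ### The `ℕ`-weight `∑ⱼ vⱼ wtⱼ` and the peeling lemma -/

/-- The `ℕ`-weight is additive. [OURS · L1 W4.5c] -/
theorem wdeg_add (wt : M → ℕ) (u v : M → ℕ) :
    ∑ j, (u + v) j * wt j = ∑ j, u j * wt j + ∑ j, v j * wt j := by
  simp only [Pi.add_apply, add_mul, Finset.sum_add_distrib]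

/-- Weight of an `ℕ`-multiple. [OURS · L1 W4.5c] -/
theorem wdeg_nsmul (wt : M → ℕ) (n : ℕ) (v : M → ℕ) : ∑ j, (n • v) j * wt j = n * ∑ j, v j * wt j := by
  simp only [Pi.smul_apply, smul_eq_mul, Finset.mul_sum, mul_assoc]

/-- Weight of an `ℕ`-combination. [OURS · L1 W4.5c] -/
theorem wdeg_finsupp_sum (wt : M → ℕ) (Λ : (M → ℕ) →₀ ℕ) :
    ∑ j, (Λ.sum fun a n => n • a) j * wt j = Λ.sum fun a n => n * ∑ j, a j * wt j := by
  simp only [Finsupp.sum, Finset.sum_apply, Pi.smul_apply, smul_eq_mul, Finset.sum_mul, Finset.mul_sum,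
    mul_assoc]
  exact Finset.sum_comm

/-- **Peeling lemma.** There are `d > 0` and `N` such that every kernel vector of weight `≥ N` is the sum of a
kernel vector of weight EXACTLY `d` and another kernel vector. (`d` = the product of the weights of the atoms of
positive weight, `N = #{such atoms} · d + 1`; pigeonhole on the multiplicities of an atom decomposition.)
[OURS · L1 W4.5c] -/
theorem exists_peel (wt : M → ℕ) :
    ∃ d : ℕ, 0 < d ∧ ∃ N : ℕ, ∀ v : M → ℕ, ∑ j, v j • δ j = 0 → N ≤ ∑ j, v j * wt j →
      ∃ u₁ u₂ : M → ℕ, v = u₁ + u₂ ∧ ∑ j, u₁ j • δ j = 0 ∧ ∑ j, u₂ j • δ j = 0 ∧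
        ∑ j, u₁ j * wt j = d := by
  classical
  set A : Finset (M → ℕ) := (atoms_finite δ).toFinset with hA
  set E : Finset (M → ℕ) := A.filter (fun a => ∑ j, a j * wt j ≠ 0) with hE
  have hEpos : ∀ a ∈ E, 0 < ∑ j, a j * wt j := fun a ha => Nat.pos_of_ne_zero (Finset.mem_filter.mp ha).2
  set d : ℕ := ∏ a ∈ E, ∑ j, a j * wt j with hd
  have hdpos : 0 < d := Finset.prod_pos hEpos
  -- the complementary factor `q a` with `q a * weight a = d`
  have hq : ∀ a ∈ E, ∃ q : ℕ, 0 < q ∧ q * ∑ j, a j * wt j = d := by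
    intro a ha
    refine ⟨∏ a' ∈ E.erase a, ∑ j, a' j * wt j,
      Finset.prod_pos fun a' ha' => hEpos a' (Finset.mem_of_mem_erase ha'), ?_⟩
    rw [hd, ← Finset.prod_erase_mul _ _ ha]
  refine ⟨d, hdpos, E.card * d + 1, fun v hv hN => ?_⟩
  obtain ⟨Λ, hΛ, hvΛ⟩ := exists_atom_decomposition δ hv
  -- some atom of positive weight occurs with multiplicity `≥ q a`
  have hbig : ∃ a ∈ E, ∃ q : ℕ, q * ∑ j, a j * wt j = d ∧ q ≤ Λ a := by
    by_contra hcon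
    push Not at hcon
    -- then every `a ∈ E` contributes `≤ d - 1` to the weight, and atoms outside `E` weigh `0`
    have hsum : ∑ j, v j * wt j = ∑ a ∈ Λ.support, Λ a * ∑ j, a j * wt j := by
      rw [hvΛ, wdeg_finsupp_sum, Finsupp.sum]
    have hle : ∑ a ∈ Λ.support, Λ a * ∑ j, a j * wt j ≤ ∑ a ∈ E, (d - 1) := by
      calc ∑ a ∈ Λ.support, Λ a * ∑ j, a j * wt j
          = ∑ a ∈ Λ.support with a ∈ E, Λ a * ∑ j, a j * wt j := by
            rw [← Finset.sum_filter_add_sum_filter_not Λ.support (· ∈ E)]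
            suffices h : ∑ a ∈ Λ.support with ¬ a ∈ E, Λ a * ∑ j, a j * wt j = 0 by rw [h, add_zero]
            refine Finset.sum_eq_zero fun a ha => ?_
            obtain ⟨haΛ, haE⟩ := Finset.mem_filter.mp ha
            have haA : a ∈ A := by rw [hA, Set.Finite.mem_toFinset]; exact hΛ a haΛ
            have : ∑ j, a j * wt j = 0 := by
              by_contra hne
              exact haE (Finset.mem_filter.mpr ⟨haA, hne⟩)
            rw [this, mul_zero]
        _ ≤ ∑ a ∈ E, Λ a * ∑ j, a j * wt j :=
            Finset.sum_le_sum_of_subset_of_nonneg (fun a ha => (Finset.mem_filter.mp ha).2)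
              (fun _ _ _ => Nat.zero_le _)
        _ ≤ ∑ a ∈ E, (d - 1) := by
            refine Finset.sum_le_sum fun a ha => ?_
            obtain ⟨q, hqpos, hqd⟩ := hq a ha
            have hlt : Λ a < q := hcon a ha q hqd
            have h1 : Λ a * ∑ j, a j * wt j ≤ (q - 1) * ∑ j, a j * wt j :=
              Nat.mul_le_mul_right _ (by omega)
            have h2 : (q - 1) * ∑ j, a j * wt j = d - ∑ j, a j * wt j := by
              rw [Nat.sub_mul, one_mul, hqd]
            have h3 := hEpos a ha
            omega
    rw [Finset.sum_const, smul_eq_mul] at hle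
    have : E.card * (d - 1) ≤ E.card * d := Nat.mul_le_mul_left _ (Nat.sub_le d 1)
    omega
  obtain ⟨a, haE, q, hqd, hqΛ⟩ := hbig
  have haA : ∑ j, a j • δ j = 0 := by
    have : a ∈ A := (Finset.mem_filter.mp haE).1
    rw [hA, Set.Finite.mem_toFinset] at this
    exact this.1
  -- `q • a ≤ v`
  have hle : q • a ≤ v := by
    intro j
    rw [hvΛ, Finsupp.sum, Finset.sum_apply]
    have hmem : a ∈ Λ.support := by
      rw [Finsupp.mem_support_iff]
      intro h0
      rw [h0, Nat.le_zero] at hqΛ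
      rw [← hqd, hqΛ, zero_mul] at hdpos
      exact lt_irrefl 0 hdpos
    calc (q • a) j = q * a j := by simp
      _ ≤ Λ a * a j := Nat.mul_le_mul_right _ hqΛ
      _ = (Λ a • a) j := by simp
      _ ≤ ∑ a' ∈ Λ.support, (Λ a' • a') j :=
          Finset.single_le_sum (f := fun a' => (Λ a' • a') j) (fun _ _ => Nat.zero_le _) hmem
  refine ⟨q • a, v - q • a, (add_tsub_cancel_of_le hle).symm, ker_nsmul haA q,
    ker_tsub (ker_nsmul haA q) hv hle, ?_⟩
  rw [wdeg_nsmul, hqd]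

end Atoms

/-! ## §2 The Veronese lemma for ideal filtrations -/

section VeroneseLemma

variable {A : Type*} [CommRing A] (F : IdealFiltration A)

/-- `F_d ^ l ≤ F_{d l}` for an ideal filtration. [OURS · L1 W4.5c] -/
theorem idealFiltration_pow_le (d l : ℕ) : F.ideal d ^ l ≤ F.ideal (d * l) := by
  induction l with
  | zero => simp [F.ideal_zero]
  | succ l ih =>
    rw [pow_succ, Nat.mul_succ]
    exact (Ideal.mul_mono_left ih).trans (F.mul_le _ _)

/-- **Veronese lemma** (Bourbaki, Alg. Comm. III §1 no. 3 Prop. 3 / EGA II (2.1.6), ideal-theoretic form): if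
`F_n ≤ F_d · F_{n - d}` for all `n ≥ N` with `d > 0`, then `e := d (N + 1)` satisfies `F_{e l} = F_e ^ l` for all `l`.
[OURS · L1 W4.5c] -/
theorem idealFiltration_exists_veronese_of_peel {d N : ℕ} (hd : 0 < d)
    (h : ∀ n, N ≤ n → F.ideal n ≤ F.ideal d * F.ideal (n - d)) :
    ∃ e : ℕ, 0 < e ∧ ∀ l : ℕ, F.ideal (e * l) = F.ideal e ^ l := by
  set e := d * (N + 1) with he
  have hepos : 0 < e := Nat.mul_pos hd (Nat.succ_pos N)
  have heN : N ≤ e := by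
    calc N ≤ N + 1 := Nat.le_succ N
      _ = 1 * (N + 1) := (one_mul _).symm
      _ ≤ d * (N + 1) := Nat.mul_le_mul_right _ hd
  -- iterate the peeling above the threshold
  have hiter : ∀ j : ℕ, F.ideal (e + d * j) ≤ F.ideal d ^ j * F.ideal e := by
    intro j
    induction j with
    | zero => simp
    | succ j ih =>
      have hNle : N ≤ e + d * (j + 1) := heN.trans (Nat.le_add_right _ _)
      calc F.ideal (e + d * (j + 1))
          ≤ F.ideal d * F.ideal (e + d * (j + 1) - d) := h _ hNle
        _ = F.ideal d * F.ideal (e + d * j) := by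
            congr 2
            rw [Nat.mul_succ, ← Nat.add_assoc, Nat.add_sub_cancel]
        _ ≤ F.ideal d * (F.ideal d ^ j * F.ideal e) := Ideal.mul_mono_right ih
        _ = F.ideal d ^ (j + 1) * F.ideal e := by rw [pow_succ', mul_assoc]
  refine ⟨e, hepos, fun l => ?_⟩
  rcases Nat.eq_zero_or_pos l with rfl | hl
  · simp [F.ideal_zero]
  · apply le_antisymm
    · -- `e l = e + d ((N+1)(l-1))`
      have hel : e * l = e + d * ((N + 1) * (l - 1)) := by
        rw [he]
        have : l = (l - 1) + 1 := (Nat.sub_add_cancel hl).symm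
        conv_lhs => rw [this]
        ring
      calc F.ideal (e * l) = F.ideal (e + d * ((N + 1) * (l - 1))) := by rw [hel]
        _ ≤ F.ideal d ^ ((N + 1) * (l - 1)) * F.ideal e := hiter _
        _ = (F.ideal d ^ (N + 1)) ^ (l - 1) * F.ideal e := by rw [pow_mul]
        _ ≤ F.ideal e ^ (l - 1) * F.ideal e := by
            refine Ideal.mul_mono_left (Ideal.pow_right_mono ?_ _)
            rw [he]
            exact idealFiltration_pow_le F d (N + 1)
        _ = F.ideal e ^ l := by
            rw [← pow_succ, Nat.sub_add_cancel hl]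
    · exact idealFiltration_pow_le F e l

end VeroneseLemma

end Summit.ResolutionOfSingularities.ResolutionOfSingularities.Theorems.WildQuotientResolution.S1.Veronese

end
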